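import Mathlib

/-!
# Coarse surjectivity by a clopen argument (location brick for line `Sketch`, crux GapDecaySuffices)

A continuous map which is open on an open set `U`, whose `U`-preimages of a preconnected target set `W`
stay inside a compact subset of `U`, and which hits `W` at least once, covers `W`.  This is the
degree-free replacement for "uniformly proper near-isometric embeddings are coarsely surjective" used to
LOCATE chart images (cards `curvature-anchored-location`, `neck-timeline-anchoring`): all charts of the
crux are open embeddings (local diffeomorphisms), so openness is free, and the compactness hypothesis is
supplied by coarse displacement bounds.  Pure topology (Mathlib only).
-/

open Set Filter Topology

namespace Summit.FinalStateConjecture.FinalStateConjecture.Theorems.GapDecaySuffices.Location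

set_option linter.dupNamespace false

/-- **Clopen surjection lemma** (registered brick `stub_clopenSurjection` of line `Sketch`, crux
`GapDecaySuffices`).  Let `h : E → F` be continuous on a set `U`, with `h` an open map
on `U` (`IsOpenMap (U.restrict h)`); let `W ⊆ F` be preconnected, and suppose every point of `U` mapped
into `W` lies in a compact set `K ⊆ U`.  If some point of `U` is mapped into `W`, then `W ⊆ h '' U`.
Proof: `W ∩ h '' U` is relatively open (open map) and relatively closed (limits of preimages stay in the
compact `K ⊆ U`, continuity) in the preconnected `W`, and non-empty. [folklore] -/
theorem stub_clopenSurjection {E F : Type*} [TopologicalSpace E]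
    [FirstCountableTopology E] [TopologicalSpace F] [T2Space F] [FirstCountableTopology F]
    {h : E → F} {U : Set E} {K : Set E} {W : Set F}
    (hcont : ContinuousOn h U) (hopen : IsOpenMap (U.restrict h))
    (hW : IsPreconnected W) (hK : IsCompact K) (hKU : K ⊆ U)
    (hpre : ∀ x ∈ U, h x ∈ W → x ∈ K) (hseed : ∃ x ∈ U, h x ∈ W) :
    W ⊆ h '' U := by
  -- the relatively open piece
  have hVopen : IsOpen (h '' U) := by
    have : h '' U = range (U.restrict h) := by
      ext y; simp [Set.mem_image]
    rw [this]
    exact hopen.isOpen_range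
  -- relative closedness inside W: closure points of `W ∩ h '' U` that lie in `W` are in `h '' U`
  have hVclosed : ∀ y ∈ W, y ∈ closure (W ∩ h '' U) → y ∈ h '' U := by
    intro y hyW hycl
    -- pick a sequence in `W ∩ h '' U` converging to `y`
    obtain ⟨u, hu, hlim⟩ := mem_closure_iff_seq_limit.1 hycl
    choose x hxU hxy using fun n ↦ (hu n).2
    have hxK : ∀ n, x n ∈ K := fun n ↦ hpre (x n) (hxU n) (by rw [hxy n]; exact (hu n).1)
    obtain ⟨x₀, hx₀K, φ, hφ, hφlim⟩ := hK.tendsto_subseq hxK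
    have hx₀U : x₀ ∈ U := hKU hx₀K
    -- continuity of `h` at `x₀` within `U`
    have h1 : Tendsto (fun n ↦ h (x (φ n))) atTop (𝓝 (h x₀)) := by
      have hc : ContinuousWithinAt h U x₀ := hcont x₀ hx₀U
      have : Tendsto (fun n ↦ x (φ n)) atTop (𝓝[U] x₀) :=
        tendsto_nhdsWithin_iff.2 ⟨hφlim, Eventually.of_forall fun n ↦ hxU (φ n)⟩
      exact hc.tendsto.comp this
    have h2 : Tendsto (fun n ↦ h (x (φ n))) atTop (𝓝 y) := by
      have : (fun n ↦ h (x (φ n))) = u ∘ φ := by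
        funext n; simp [Function.comp, hxy]
      rw [this]
      exact hlim.comp hφ.tendsto_atTop
    have : h x₀ = y := tendsto_nhds_unique h1 h2
    exact ⟨x₀, hx₀U, this⟩
  -- clopen argument in the preconnected `W`
  intro y hyW
  by_contra hy
  obtain ⟨x₁, hx₁U, hx₁W⟩ := hseed
  have hcover : W ⊆ h '' U ∪ (closure (W ∩ h '' U))ᶜ := by
    intro z hz
    by_cases hzc : z ∈ closure (W ∩ h '' U)
    · exact Or.inl (hVclosed z hz hzc)
    · exact Or.inr hzc
  have hne1 : (W ∩ h '' U).Nonempty := ⟨h x₁, hx₁W, x₁, hx₁U, rfl⟩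
  have hne2 : (W ∩ (closure (W ∩ h '' U))ᶜ).Nonempty := by
    refine ⟨y, hyW, fun hyc ↦ hy (hVclosed y hyW hyc)⟩
  obtain ⟨z, hzW, hzU, hzc⟩ := hW _ _ hVopen isClosed_closure.isOpen_compl hcover hne1 hne2
  exact hzc (subset_closure ⟨hzW, hzU⟩)

/-- **Coarse surjectivity of a located open map on a ball** (registered brick `stub_ballSubsetImage`) (finite-dimensional real normed space): if
`h` is continuous on the closed ball `closedBall c R`, open on the open ball, and displaces points by at
most `κ` (`‖h x − x‖ ≤ κ` on the closed ball) with `2κ < R`, then `h '' ball c R ⊇ ball c (R − 2κ)`.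
Corollary of the clopen surjection lemma with `K = closedBall c (R − ε)`. [folklore] -/
theorem stub_ballSubsetImage {E : Type*} [NormedAddCommGroup E]
    [NormedSpace ℝ E] [FiniteDimensional ℝ E] {h : E → E} {c : E} {R κ : ℝ}
    (hcont : ContinuousOn h (Metric.closedBall c R)) (hopen : IsOpenMap ((Metric.ball c R).restrict h))
    (hdisp : ∀ x ∈ Metric.closedBall c R, ‖h x - x‖ ≤ κ) (hκ : 0 ≤ κ) (hR : 2 * κ < R) :
    Metric.ball c (R - 2 * κ) ⊆ h '' Metric.ball c R := by
  intro y hy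
  rw [Metric.mem_ball, dist_eq_norm] at hy
  -- margins
  set ε : ℝ := min ((R - 2 * κ - ‖y - c‖) / 2) ((R - 2 * κ) / 2) with hε
  have hε0 : 0 < ε := by
    rw [hε]; refine lt_min (by linarith) (by linarith)
  have hε1 : ε ≤ (R - 2 * κ - ‖y - c‖) / 2 := min_le_left _ _
  have hε2 : ε ≤ (R - 2 * κ) / 2 := min_le_right _ _
  -- target `W` and compact `K`
  set W : Set E := Metric.ball c (R - κ - ε) with hW
  have hyW : y ∈ W := by
    rw [hW, Metric.mem_ball, dist_eq_norm]; linarith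
  have hsub : W ⊆ h '' Metric.ball c R := by
    refine stub_clopenSurjection (U := Metric.ball c R)
      (K := Metric.closedBall c (R - ε)) (hcont.mono Metric.ball_subset_closedBall) hopen
      (convex_ball c _).isPreconnected (isCompact_closedBall c _) ?_ ?_ ?_
    · exact Metric.closedBall_subset_ball (by linarith)
    · intro x hx hxW
      rw [hW, Metric.mem_ball, dist_eq_norm] at hxW
      rw [Metric.mem_closedBall, dist_eq_norm]
      have h1 := hdisp x (Metric.ball_subset_closedBall hx)
      have : ‖x - c‖ ≤ ‖h x - c‖ + ‖h x - x‖ := by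
        calc ‖x - c‖ = ‖(h x - c) - (h x - x)‖ := by congr 1; abel
          _ ≤ ‖h x - c‖ + ‖h x - x‖ := norm_sub_le _ _
      linarith
    · refine ⟨c, Metric.mem_ball_self (by linarith), ?_⟩
      rw [hW, Metric.mem_ball, dist_eq_norm]
      have h1 := hdisp c (Metric.mem_closedBall_self (by linarith))
      linarith
  exact hsub hyW

end Summit.FinalStateConjecture.FinalStateConjecture.Theorems.GapDecaySuffices.Location
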